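import Literature.MathematicalPhysics.QuantumFieldTheory.Balaban1983to89.Beta.DressedMomentNormalisation
import Literature.MathematicalPhysics.QuantumFieldTheory.Balaban1983to89.Beta.GradedBubbles
import Literature.MathematicalPhysics.QuantumFieldTheory.Balaban1983to89.B12Beta

/-!
# `BalabanUV.Beta.FP.HorizontalBookkeeping` — road «FP», N7 H-route, row H3-BOOK (a): THE TRUNCATED TRANSPORT IDENTITY WITHOUT THE (T0)/(T1)
# HYPOTHESES — the decimated second moment of an entry of the dressed kernel `Wᵀ·T·W` is `N^{−(d+2)}·M₂(T) + (T0)-DEFECT`, the defect DISPLAYED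
# (bilinear in the zeroth moments `M₀(T c e)` and the second ∕ first ∕ affine-reproduction moments of `W`); (T1) discharged by EVENNESS of `T`;
# specialisation to the symmetric truncation `K·1_{‖·‖∞ ≤ R}` of an even kernel on `ℤ⁴` ([folklore] bookkeeping over the tree's nine-term master identity)

HONEST DEPENDENCY (page 1, mandatory): continuum YM on T⁴ ⇐ BetaPertH ∧ nine spine estimates (0/9 proved); BetaPertH ⇐ (D1) ∧ (D4) ∧
CAP+tail; G-an2-4 gates asym, D1 and NE2/3/4.  HONEST FRAMING (cell contract, verbatim): «discharging `BetaPertH` makes Bałaban's UV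
stability UNCONDITIONAL — a real constructive-QFT result; it is NOT the continuum limit and NOT the Clay problem.»  THIS MODULE composes BY NAME the
tree's [folklore] lattice bookkeeping: b12's NINE-TERM MASTER IDENTITY `DecimatedMomentSummable.hasSum_term_second` (NO vanishing hypothesis on `T`),
`hasSum_coarse`, `DecimatedMomentLimit.hasSum_decimate_iff`, `DressedMomentNormalisation.dressedEntry`/`hasSum_total_of_constReproSum`, the
`AbsMoment₂` summability package (`monoSummable_of_absMoment₂`, `summable_smul_of_absMoment₂`, `summable_dressed_fibre`).  It cites nothing, mints no
`Prop` fact, 0 sorry; its two `def`s (`t0Defect`, `truncK`) are data.  Every analytic input (affine reproduction of `W`, absolute second moments,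
evenness) is a HYPOTHESIS displayed in the signatures.  NOT (H1), NOT (H3-b) (the tail comparison), NOT `hasym`, NOT D1, NOT BetaPertH, NOT continuum, NOT Clay.

ROW (owner d1-p3-g4, R-FP-15 ∕ `N7-PROOF.v2.md` §3, LEAVES-FP «N7/H3-BOOK» (a)): «TRUNCATED TRANSPORT
`M₂[(z ↦ N⁸·dressedEntry w (K·1_{‖·‖≤R}) (N•z))] = M₂[K·1_{‖·‖≤R}] + M₀[K·1_{‖·‖≤R}]·(explicit w-moment)` (`secondMoment_dressedEntry_hasSum_lattice` pattern
WITHOUT the (T0)/(T1) hypotheses — the (T0)-defect term is displayed; for R = N and `|M₀[K·1_{≤N}]| ≤ C'N⁻²` it is O(1))».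

CONTENT.
* §1 `decimatedSum_second_moment_hasSum_lattice_nine`: the scalar nine-term identity on the decimated lattice — for `w, T, w′ : ℤ^d → ℝ` with absolute second
  moments, `ConstReproSum N w σ`, `LinReproSum N w C`, `ConstReproSum N w′ σ′`:
  `Σ_z N² z_κ z_λ · dressedSum w T w′ (N•z) = σm₂n₀ + σm₁κn₁λ + σm₁λn₁κ − C_λm₁κn₀ − C_κm₁λn₀ + σm₀n₂ − C_λm₀n₁κ − C_κm₀n₁λ + p₂m₀σ′` (all moments as `tsum`s).
* §2 EVENNESS KILLS THE FIRST MOMENTS: `tsum_coord_smul_eq_zero_of_even`; `…_nine_even` (the value with `m₁ = 0`).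
* §3 THE ENTRYWISE IDENTITY WITH THE (T0)-DEFECT DISPLAYED (`t0Defect`): `secondMoment_dressedEntry_hasSum_lattice_t0Defect` — Kronecker masses
  `δ_{κl}·N^{−(d+1)}` (L0∞), affine constants `Cw κ l` (L1∞), absolute second moments, `T` entrywise EVEN:
  `HasSum (z ↦ (N² z_κ z_λ) • dressedEntry w T (N•z) a b) (N^{−(d+2)}·Σ'_t t_κt_λ T a b t + t0Defect N w T Cw κ λ a b)`; `t0Defect_eq_zero_of_T0` (consistency with
  the (T0) case); `abs_t0Defect_le` (abstract size).
* §4 `d = 4`, COARSE units: `hasSum_coarse_secondMoment_t0Defect` (`Σ_z z_κz_λ·(N⁸·dressedEntry … (N•z)) = M₂(T a b) + N⁶·t0Defect`),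
  `secondMoment_transport_eq` (the same in `B12Beta.secondMoment` vocabulary: `secondMoment (N⁸·dressedEntry w T (N•·)) μ ν = secondMoment T μ ν + N⁶·t0Defect`),
  `pow_six_mul_abs_t0Defect_le` (`N⁶·|t0Defect| ≤ 16A(2c₂ + 2c_C c₁)` under `|M₀(T)| ≤ A/N²` and N-uniform profile letters — the row's «it is O(1)»), and the
  SYMMETRIC TRUNCATION `truncK K R` of an even kernel (`truncK_even`, `absMoment₂_truncK`), whence `hasSum_coarse_secondMoment_truncK` — the row's (a) with
  every binder displayed.
Unit `b2b-balaban-beta-d1-formalise-leaf-02` (gen 5).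
-/

noncomputable section

namespace Summit.QuantumFields.BalabanUV.Beta.FP.HorizontalBookkeeping

open Finset Filter Topology
open scoped BigOperators
open Literature.MathematicalPhysics.QuantumFieldTheory.Balaban1983to89
open Literature.MathematicalPhysics.QuantumFieldTheory.Balaban1983to89.Beta
open DecimatedMoment (cosetInd)
open DecimatedMomentLimit (hasSum_decimate_iff weight_zsmul abs_cosetInd_le_one)
open DecimatedMomentSummable (IsMoment₂ MonoSummable ConstReproSum LinReproSum constReproSum_iff_right hasSum_term_second hasSum_coarse
  dressedSum AbsMoment₂ monoSummable_of_absMoment₂ summable_smul_of_absMoment₂ summable_of_absMoment₂ summable_dressed_fibre)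
open DressedMomentNormalisation (EKer dressedEntry hasSum_total_of_constReproSum)
open B12Sec2to5 (l1 l1_nonneg)

variable {d N : ℕ}

/-! ## §1 The nine-term identity on the decimated lattice (all three factors infinitely extended, over `ℝ`) -/

/-- **THE NINE-TERM IDENTITY ON THE DECIMATED LATTICE** (NO vanishing hypothesis on `T`): `w` reproduces constants (`σ`) and affine functions (`C`)
through the window `N•ℤ^d`, `w′` reproduces constants (`σ′`), all three factors have absolute second moments; then
`Σ_z (N² z_κ z_λ) • dressedSum w T w′ (N•z)` has the sum given by b12's nine-term right member with the infinite moments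
`m₀, m₁κ, m₁λ, m₂` of `T`, `n₀, n₁κ, n₁λ, n₂` of `w′`, `p₂` of `w`. [folklore] -/
theorem decimatedSum_second_moment_hasSum_lattice_nine (hN : N ≠ 0) (w T w' : (Fin d → ℤ) → ℝ) {σ σ' : ℝ} {C : Fin d → ℝ}
    (hw : ConstReproSum N w σ) (hw1 : LinReproSum N w C) (hR : ConstReproSum N w' σ')
    (hwA : AbsMoment₂ w) (hTA : AbsMoment₂ T) (hw'A : AbsMoment₂ w') (κ l : Fin d) :
    HasSum (fun z : Fin d → ℤ => ((N : ℤ) ^ 2 * (z κ * z l)) • dressedSum w T w' ((N : ℤ) • z))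
      (σ * (∑' t, (t κ * t l) • T t) * (∑' x, w' x) + σ * (∑' t, t κ • T t) * (∑' x, x l • w' x)
        + σ * (∑' t, t l • T t) * (∑' x, x κ • w' x) - C l * (∑' t, t κ • T t) * (∑' x, w' x)
        - C κ * (∑' t, t l • T t) * (∑' x, w' x) + σ * (∑' t, T t) * (∑' x, (x κ * x l) • w' x)
        - C l * (∑' t, T t) * (∑' x, x κ • w' x) - C κ * (∑' t, T t) * (∑' x, x l • w' x)
        + (∑' u, (u κ * u l) • w u) * (∑' t, T t) * σ') := by
  have h9 := hasSum_term_second (cosetInd N) w T w' hw hw1 ((constReproSum_iff_right N w' σ').1 hR) κ l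
    (summable_of_absMoment₂ hTA).hasSum (summable_smul_of_absMoment₂ hTA (IsMoment₂.coord κ)).hasSum
    (summable_smul_of_absMoment₂ hTA (IsMoment₂.coord l)).hasSum (summable_smul_of_absMoment₂ hTA (IsMoment₂.coord2 κ l)).hasSum
    (summable_of_absMoment₂ hw'A).hasSum (summable_smul_of_absMoment₂ hw'A (IsMoment₂.coord κ)).hasSum
    (summable_smul_of_absMoment₂ hw'A (IsMoment₂.coord l)).hasSum (summable_smul_of_absMoment₂ hw'A (IsMoment₂.coord2 κ l)).hasSum
    (summable_smul_of_absMoment₂ hwA (IsMoment₂.coord2 κ l)).hasSum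
    (monoSummable_of_absMoment₂ (abs_cosetInd_le_one N) hwA hTA hw'A)
  have hc := hasSum_coarse (cosetInd N) w T w' (fun y => y κ * y l) h9 (fun y => summable_dressed_fibre hwA hTA hw'A y)
  have h := (hasSum_decimate_iff hN (fun y => y κ * y l) (dressedSum w T w') _).2 hc
  refine h.congr_fun (fun z => ?_)
  simp only [weight_zsmul]

/-! ## §2 Evenness kills the first moments -/

/-- [folklore] **AN EVEN KERNEL HAS VANISHING FIRST MOMENTS**: `T (−t) = T t` for all `t` and an absolute second moment ⟹ `Σ'_t t_κ • T t = 0`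
(the summand is odd under the involution `t ↦ −t`). -/
theorem tsum_coord_smul_eq_zero_of_even {T : (Fin d → ℤ) → ℝ} (heven : ∀ t, T (-t) = T t) (κ : Fin d) :
    ∑' t : Fin d → ℤ, t κ • T t = 0 := by
  have h1 : ∑' t : Fin d → ℤ, (-t) κ • T (-t) = ∑' t : Fin d → ℤ, t κ • T t :=
    (Equiv.neg (Fin d → ℤ)).tsum_eq (fun t => t κ • T t)
  have h2 : ∑' t : Fin d → ℤ, (-t) κ • T (-t) = -∑' t : Fin d → ℤ, t κ • T t := by
    rw [← tsum_neg]
    refine tsum_congr fun t => ?_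
    rw [heven, Pi.neg_apply, neg_smul]
  linarith

/-- [folklore] The nine-term identity for an EVEN kernel: the four `m₁`-terms drop, leaving `σ·m₂·n₀ + m₀·(σ·n₂ − C_λ·n₁κ − C_κ·n₁λ + p₂·σ′)`. -/
theorem decimatedSum_second_moment_hasSum_lattice_even (hN : N ≠ 0) (w T w' : (Fin d → ℤ) → ℝ) {σ σ' : ℝ} {C : Fin d → ℝ}
    (hw : ConstReproSum N w σ) (hw1 : LinReproSum N w C) (hR : ConstReproSum N w' σ')
    (hwA : AbsMoment₂ w) (hTA : AbsMoment₂ T) (hw'A : AbsMoment₂ w') (heven : ∀ t, T (-t) = T t) (κ l : Fin d) :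
    HasSum (fun z : Fin d → ℤ => ((N : ℤ) ^ 2 * (z κ * z l)) • dressedSum w T w' ((N : ℤ) • z))
      (σ * (∑' t, (t κ * t l) • T t) * (∑' x, w' x)
        + (∑' t, T t) * (σ * (∑' x, (x κ * x l) • w' x) - C l * (∑' x, x κ • w' x) - C κ * (∑' x, x l • w' x)
            + (∑' u, (u κ * u l) • w u) * σ')) := by
  have h := decimatedSum_second_moment_hasSum_lattice_nine hN w T w' hw hw1 hR hwA hTA hw'A κ l
  rw [tsum_coord_smul_eq_zero_of_even heven κ, tsum_coord_smul_eq_zero_of_even heven l] at h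
  convert h using 1
  ring

/-! ## §3 The entrywise identity with the (T0)-defect displayed -/

/-- [folklore] **THE (T0)-DEFECT** of the decimated second moment of the `(a, b)` entry of `Wᵀ·T·W` (Kronecker masses `δ·N^{−(d+1)}`, affine constants
`Cw κ l μ`): `Σ_{c,e} M₀(T c e)·(δ_{ca}N^{−(d+1)}·M₂^{κλ}(w e b) − Cw c a λ·M₁^{κ}(w e b) − Cw c a κ·M₁^{λ}(w e b) + M₂^{κλ}(w c a)·δ_{eb}N^{−(d+1)})`.
It VANISHES when every `M₀(T c e) = 0` ((T0)); nothing here assumes that. -/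
def t0Defect (N : ℕ) (w T : EKer d) (Cw : Fin d → Fin d → Fin d → ℝ) (κ l a b : Fin d) : ℝ :=
  ∑ c, ∑ e, (∑' t, T c e t)
    * ((if c = a then (((N : ℝ) ^ (d + 1))⁻¹) else 0) * (∑' x, (x κ * x l) • w e b x) - Cw c a l * (∑' x, x κ • w e b x)
        - Cw c a κ * (∑' x, x l • w e b x) + (∑' u, (u κ * u l) • w c a u) * (if e = b then (((N : ℝ) ^ (d + 1))⁻¹) else 0))

/-- [folklore] CONSISTENCY: under (T0) (`M₀(T c e) = 0` for all `c, e`) the defect vanishes — the identity below then IS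
`DressedMomentNormalisation.secondMoment_dressedEntry_hasSum_lattice`'s value. -/
theorem t0Defect_eq_zero_of_T0 (N : ℕ) (w T : EKer d) (Cw : Fin d → Fin d → Fin d → ℝ) (κ l a b : Fin d)
    (hT0 : ∀ c e, ∑' t, T c e t = 0) : t0Defect N w T Cw κ l a b = 0 := by
  simp [t0Defect, hT0]

/-- **THE DECIMATED SECOND MOMENT OF AN ENTRY OF THE DRESSED KERNEL, (T0)-DEFECT DISPLAYED** (spec normalisation, NO (T0)/(T1) hypothesis; `T` entrywise
EVEN instead of (T1)): entrywise (L0∞) with the Kronecker masses `δ_{κl}·N^{−(d+1)}`, entrywise (L1∞) with constants `Cw κ l`, absolute second moments of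
`w` and `T`; then `z ↦ (N² z_κ z_λ) • K_{ab}(N z)` has the sum `N^{−(d+2)}·Σ'_t t_κ t_λ T a b t + t0Defect N w T Cw κ λ a b`. [folklore] -/
theorem secondMoment_dressedEntry_hasSum_lattice_t0Defect (hN : 0 < N) (w T : EKer d) (Cw : Fin d → Fin d → Fin d → ℝ)
    (hw0 : ∀ κ l, ConstReproSum N (w κ l) (if κ = l then (((N : ℝ) ^ (d + 1))⁻¹) else 0))
    (hw1 : ∀ κ l, LinReproSum N (w κ l) (Cw κ l))
    (hwA : ∀ κ l, AbsMoment₂ (w κ l)) (hTA : ∀ c e, AbsMoment₂ (T c e)) (heven : ∀ c e t, T c e (-t) = T c e t)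
    (κ lam a b : Fin d) :
    HasSum (fun z : Fin d → ℤ => ((N : ℤ) ^ 2 * (z κ * z lam)) • dressedEntry w T ((N : ℤ) • z) a b)
      ((((N : ℝ) ^ (d + 2))⁻¹) * (∑' t, (t κ * t lam) • T a b t) + t0Defect N w T Cw κ lam a b) := by
  have hNne : N ≠ 0 := hN.ne'
  -- the scalar identity for each pair (c, e), with `n₀ = N^d · σ′`
  have hce : ∀ c e : Fin d,
      HasSum (fun z : Fin d → ℤ => ((N : ℤ) ^ 2 * (z κ * z lam)) • dressedSum (w c a) (T c e) (w e b) ((N : ℤ) • z))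
        ((if c = a then (((N : ℝ) ^ (d + 1))⁻¹) else 0) * (∑' t, (t κ * t lam) • T c e t)
            * ((N : ℝ) ^ d * (if e = b then (((N : ℝ) ^ (d + 1))⁻¹) else 0))
          + (∑' t, T c e t) * ((if c = a then (((N : ℝ) ^ (d + 1))⁻¹) else 0) * (∑' x, (x κ * x lam) • w e b x)
              - Cw c a lam * (∑' x, x κ • w e b x) - Cw c a κ * (∑' x, x lam • w e b x)
              + (∑' u, (u κ * u lam) • w c a u) * (if e = b then (((N : ℝ) ^ (d + 1))⁻¹) else 0))) := by
    intro c e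
    have h := decimatedSum_second_moment_hasSum_lattice_even hNne (w c a) (T c e) (w e b) (hw0 c a) (hw1 c a) (hw0 e b)
      (hwA c a) (hTA c e) (hwA e b) (heven c e) κ lam
    rwa [(hasSum_total_of_constReproSum hN (hw0 e b)).tsum_eq] at h
  have hs := hasSum_sum (s := (Finset.univ : Finset (Fin d)))
    (fun c _ => hasSum_sum (s := (Finset.univ : Finset (Fin d))) (fun e _ => hce c e))
  -- collapse the Kronecker masses in the main term
  have hval : ∑ c, ∑ e, ((if c = a then (((N : ℝ) ^ (d + 1))⁻¹) else 0) * (∑' t, (t κ * t lam) • T c e t)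
        * ((N : ℝ) ^ d * (if e = b then (((N : ℝ) ^ (d + 1))⁻¹) else 0))
        + (∑' t, T c e t) * ((if c = a then (((N : ℝ) ^ (d + 1))⁻¹) else 0) * (∑' x, (x κ * x lam) • w e b x)
            - Cw c a lam * (∑' x, x κ • w e b x) - Cw c a κ * (∑' x, x lam • w e b x)
            + (∑' u, (u κ * u lam) • w c a u) * (if e = b then (((N : ℝ) ^ (d + 1))⁻¹) else 0)))
      = (((N : ℝ) ^ (d + 2))⁻¹) * (∑' t, (t κ * t lam) • T a b t) + t0Defect N w T Cw κ lam a b := by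
    simp only [Finset.sum_add_distrib]
    congr 1
    simp only [mul_ite, mul_zero, ite_mul, zero_mul, Finset.sum_ite_eq', Finset.mem_univ, if_true]
    have hN' : (N : ℝ) ≠ 0 := by exact_mod_cast hNne
    field_simp
    ring
  rw [hval] at hs
  refine hs.congr_fun (fun z => ?_)
  simp only [dressedEntry, Finset.smul_sum]

/-- [folklore] **ABSTRACT SIZE OF THE (T0)-DEFECT**: with `|M₀(T c e)| ≤ A`, `|M₂^{κλ}(w e b)| ≤ B₂`, `|M₂^{κλ}(w c a)| ≤ B₂`, `|M₁(w e b)| ≤ B₁`,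
`|Cw c a μ| ≤ B_C` (all `c, e, μ`): `|t0Defect| ≤ d²·A·(2·N^{−(d+1)}·B₂ + 2·B_C·B₁)`. -/
theorem abs_t0Defect_le (w T : EKer d) (Cw : Fin d → Fin d → Fin d → ℝ) (κ l a b : Fin d) {A B₁ B₂ BC : ℝ}
    (hA : ∀ c e, |∑' t, T c e t| ≤ A) (hB2 : ∀ c e, |∑' x, (x κ * x l) • w c e x| ≤ B₂)
    (hB1 : ∀ c e (μ : Fin d), |∑' x, x μ • w c e x| ≤ B₁) (hBC : ∀ c e (μ : Fin d), |Cw c e μ| ≤ BC) :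
    |t0Defect N w T Cw κ l a b| ≤ (d : ℝ) ^ 2 * (A * (2 * (((N : ℝ) ^ (d + 1))⁻¹) * B₂ + 2 * BC * B₁)) := by
  have hA0 : 0 ≤ A := (abs_nonneg _).trans (hA a b)
  have hB10 : 0 ≤ B₁ := (abs_nonneg _).trans (hB1 a b κ)
  have hB20 : 0 ≤ B₂ := (abs_nonneg _).trans (hB2 a b)
  have hBC0 : 0 ≤ BC := (abs_nonneg _).trans (hBC a b κ)
  have hNi : 0 ≤ (((N : ℝ) ^ (d + 1))⁻¹) := by positivity
  have hδ : ∀ (c e : Fin d), |(if c = e then (((N : ℝ) ^ (d + 1))⁻¹) else 0)| ≤ (((N : ℝ) ^ (d + 1))⁻¹) := by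
    intro c e; split_ifs <;> simp [abs_of_nonneg hNi, hNi]
  unfold t0Defect
  calc |∑ c, ∑ e, (∑' t, T c e t)
          * ((if c = a then (((N : ℝ) ^ (d + 1))⁻¹) else 0) * (∑' x, (x κ * x l) • w e b x) - Cw c a l * (∑' x, x κ • w e b x)
              - Cw c a κ * (∑' x, x l • w e b x) + (∑' u, (u κ * u l) • w c a u) * (if e = b then (((N : ℝ) ^ (d + 1))⁻¹) else 0))|
      ≤ ∑ c, ∑ e, A * (2 * (((N : ℝ) ^ (d + 1))⁻¹) * B₂ + 2 * BC * B₁) := by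
        refine (abs_sum_le_sum_abs _ _).trans (sum_le_sum fun c _ => (abs_sum_le_sum_abs _ _).trans (sum_le_sum fun e _ => ?_))
        rw [abs_mul]
        refine mul_le_mul (hA c e) ?_ (abs_nonneg _) hA0
        have t1 : |(if c = a then (((N : ℝ) ^ (d + 1))⁻¹) else 0) * (∑' x, (x κ * x l) • w e b x)| ≤ (((N : ℝ) ^ (d + 1))⁻¹) * B₂ := by
          rw [abs_mul]; exact mul_le_mul (hδ c a) (hB2 e b) (abs_nonneg _) hNi
        have t2 : |Cw c a l * (∑' x, x κ • w e b x)| ≤ BC * B₁ := by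
          rw [abs_mul]; exact mul_le_mul (hBC c a l) (hB1 e b κ) (abs_nonneg _) hBC0
        have t3 : |Cw c a κ * (∑' x, x l • w e b x)| ≤ BC * B₁ := by
          rw [abs_mul]; exact mul_le_mul (hBC c a κ) (hB1 e b l) (abs_nonneg _) hBC0
        have t4 : |(∑' u, (u κ * u l) • w c a u) * (if e = b then (((N : ℝ) ^ (d + 1))⁻¹) else 0)| ≤ B₂ * (((N : ℝ) ^ (d + 1))⁻¹) := by
          rw [abs_mul]; exact mul_le_mul (hB2 c a) (hδ e b) (abs_nonneg _) hB20
        calc _ ≤ |(if c = a then (((N : ℝ) ^ (d + 1))⁻¹) else 0) * (∑' x, (x κ * x l) • w e b x) - Cw c a l * (∑' x, x κ • w e b x)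
              - Cw c a κ * (∑' x, x l • w e b x)| + |(∑' u, (u κ * u l) • w c a u) * (if e = b then (((N : ℝ) ^ (d + 1))⁻¹) else 0)| :=
              abs_add_le _ _
          _ ≤ (|(if c = a then (((N : ℝ) ^ (d + 1))⁻¹) else 0) * (∑' x, (x κ * x l) • w e b x) - Cw c a l * (∑' x, x κ • w e b x)|
              + |Cw c a κ * (∑' x, x l • w e b x)|) + B₂ * (((N : ℝ) ^ (d + 1))⁻¹) := add_le_add (abs_sub _ _) t4
          _ ≤ ((|(if c = a then (((N : ℝ) ^ (d + 1))⁻¹) else 0) * (∑' x, (x κ * x l) • w e b x)| + |Cw c a l * (∑' x, x κ • w e b x)|)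
              + BC * B₁) + B₂ * (((N : ℝ) ^ (d + 1))⁻¹) := by gcongr; exact abs_sub _ _
          _ ≤ (((((N : ℝ) ^ (d + 1))⁻¹) * B₂ + BC * B₁) + BC * B₁) + B₂ * (((N : ℝ) ^ (d + 1))⁻¹) := by gcongr
          _ = 2 * (((N : ℝ) ^ (d + 1))⁻¹) * B₂ + 2 * BC * B₁ := by ring
    _ = (d : ℝ) ^ 2 * (A * (2 * (((N : ℝ) ^ (d + 1))⁻¹) * B₂ + 2 * BC * B₁)) := by
        rw [sum_const, card_univ, Fintype.card_fin, nsmul_eq_mul, sum_const, card_univ, Fintype.card_fin, nsmul_eq_mul]; ring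

/-! ## §4 `d = 4`: coarse units and the symmetric truncation of an even kernel -/

section Four

open DyadicShell (Pt supNorm)
open GradedBubbles (supNorm_neg)
open Literature.Probability.LatticeModels (box)

variable {N : ℕ}

/-- **COARSE UNITS** (`d = 4`): `Σ_z z_κ z_λ · (N⁸ · K_{ab}(N z)) = M₂^{κλ}(T a b) + N⁶ · t0Defect` — the row's «TRUNCATED TRANSPORT» value with the (T0)-defect displayed
(for (T0) kernels the second summand is `0` and this is `DressedMomentNormalisation.bondSecondMoment_hasSum_four`). [folklore] -/
theorem hasSum_coarse_secondMoment_t0Defect (hN : 0 < N) (w T : EKer 4) (Cw : Fin 4 → Fin 4 → Fin 4 → ℝ)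
    (hw0 : ∀ κ l, ConstReproSum N (w κ l) (if κ = l then (((N : ℝ) ^ (4 + 1))⁻¹) else 0))
    (hw1 : ∀ κ l, LinReproSum N (w κ l) (Cw κ l))
    (hwA : ∀ κ l, AbsMoment₂ (w κ l)) (hTA : ∀ c e, AbsMoment₂ (T c e)) (heven : ∀ c e t, T c e (-t) = T c e t)
    (κ lam a b : Fin 4) :
    HasSum (fun z : Fin 4 → ℤ => ((z κ * z lam : ℤ) : ℝ) * ((N : ℝ) ^ 8 * dressedEntry w T ((N : ℤ) • z) a b))
      ((∑' t, (t κ * t lam) • T a b t) + (N : ℝ) ^ 6 * t0Defect N w T Cw κ lam a b) := by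
  have h := (secondMoment_dressedEntry_hasSum_lattice_t0Defect hN w T Cw hw0 hw1 hwA hTA heven κ lam a b).mul_left ((N : ℝ) ^ 6)
  have hN' : (N : ℝ) ≠ 0 := by exact_mod_cast hN.ne'
  have hv : (N : ℝ) ^ 6 * ((((N : ℝ) ^ (4 + 2))⁻¹) * (∑' t : Fin 4 → ℤ, (t κ * t lam) • T a b t) + t0Defect N w T Cw κ lam a b)
      = (∑' t : Fin 4 → ℤ, (t κ * t lam) • T a b t) + (N : ℝ) ^ 6 * t0Defect N w T Cw κ lam a b := by
    field_simp
  rw [hv] at h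
  refine h.congr_fun (fun z => ?_)
  simp only [zsmul_eq_mul, Int.cast_mul, Int.cast_pow, Int.cast_natCast]
  ring

/-- **IN THE END's VOCABULARY** (`B12Beta.secondMoment`, the (1.22) moment `Σ'_z P μ ν z·z_μ·z_ν`): the transported kernel
`RP a b z := N⁸·dressedEntry w T (N•z) a b` has `secondMoment RP μ ν = secondMoment T μ ν + N⁶·t0Defect N w T Cw μ ν μ ν` — the shape in which
`FP/StepDefectInherit` ∕ the H4 assembly read transported kernels. [folklore] -/
theorem secondMoment_transport_eq (hN : 0 < N) (w T : EKer 4) (Cw : Fin 4 → Fin 4 → Fin 4 → ℝ)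
    (hw0 : ∀ κ l, ConstReproSum N (w κ l) (if κ = l then (((N : ℝ) ^ (4 + 1))⁻¹) else 0))
    (hw1 : ∀ κ l, LinReproSum N (w κ l) (Cw κ l))
    (hwA : ∀ κ l, AbsMoment₂ (w κ l)) (hTA : ∀ c e, AbsMoment₂ (T c e)) (heven : ∀ c e t, T c e (-t) = T c e t) (μ ν : Fin 4) :
    B12Beta.secondMoment (fun a b z => (N : ℝ) ^ 8 * dressedEntry w T ((N : ℤ) • z) a b) μ ν
      = B12Beta.secondMoment T μ ν + (N : ℝ) ^ 6 * t0Defect N w T Cw μ ν μ ν := by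
  have h := (hasSum_coarse_secondMoment_t0Defect hN w T Cw hw0 hw1 hwA hTA heven μ ν μ ν).tsum_eq
  unfold B12Beta.secondMoment
  have e1 : (fun z : Fin 4 → ℤ => (N : ℝ) ^ 8 * dressedEntry w T ((N : ℤ) • z) μ ν * (z μ : ℝ) * (z ν : ℝ))
      = fun z : Fin 4 → ℤ => ((z μ * z ν : ℤ) : ℝ) * ((N : ℝ) ^ 8 * dressedEntry w T ((N : ℤ) • z) μ ν) := by
    funext z; push_cast; ring
  have e2 : (fun t : Fin 4 → ℤ => T μ ν t * (t μ : ℝ) * (t ν : ℝ)) = fun t : Fin 4 → ℤ => (t μ * t ν) • T μ ν t := by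
    funext t; rw [zsmul_eq_mul]; push_cast; ring
  rw [e1, h, e2]

/-- **THE (T0)-DEFECT IS O(1) IN COARSE UNITS UNDER THE ROW'S SMALLNESS** (`d = 4`): if `|M₀(T c e)| ≤ A/N²` (e.g. `T = K·1_{≤N}` with a summable even
`K` of total mass `0`-germ), the transport weights have second moments `≤ c₂·N`, first moments `≤ c₁`, and affine constants `≤ c_C/N⁴` (the N-UNIFORM profile
letters of the row), then `N⁶·|t0Defect| ≤ 16·A·(2c₂ + 2c_C·c₁)` — free of `N`. [folklore] -/
theorem pow_six_mul_abs_t0Defect_le (hN : 0 < N) (w T : EKer 4) (Cw : Fin 4 → Fin 4 → Fin 4 → ℝ) (κ l a b : Fin 4) {A c₁ c₂ cC : ℝ}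
    (hA : ∀ c e, |∑' t, T c e t| ≤ A / (N : ℝ) ^ 2) (hB2 : ∀ c e, |∑' x, (x κ * x l) • w c e x| ≤ c₂ * N)
    (hB1 : ∀ c e (μ : Fin 4), |∑' x, x μ • w c e x| ≤ c₁) (hBC : ∀ c e (μ : Fin 4), |Cw c e μ| ≤ cC / (N : ℝ) ^ 4) :
    (N : ℝ) ^ 6 * |t0Defect N w T Cw κ l a b| ≤ 16 * A * (2 * c₂ + 2 * cC * c₁) := by
  have hN' : (0 : ℝ) < N := by exact_mod_cast hN
  have h := abs_t0Defect_le (N := N) w T Cw κ l a b hA hB2 hB1 hBC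
  have e : ((4 : ℕ) : ℝ) ^ 2 * (A / (N : ℝ) ^ 2 * (2 * (((N : ℝ) ^ (4 + 1))⁻¹) * (c₂ * N) + 2 * (cC / (N : ℝ) ^ 4) * c₁))
      = 16 * A * (2 * c₂ + 2 * cC * c₁) / (N : ℝ) ^ 6 := by
    field_simp
    ring
  rw [e, le_div_iff₀ (by positivity)] at h
  linarith

/-- [folklore] THE SYMMETRIC TRUNCATION of a matrix kernel on `ℤ⁴` to the sup-ball of radius `R`: `truncK K R c e t := K c e t` if `‖t‖∞ ≤ R`, else `0`. -/
def truncK (K : EKer 4) (R : ℕ) : EKer 4 := fun c e t => if supNorm t ≤ R then K c e t else 0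

/-- [folklore] Unfolding. -/
theorem truncK_apply (K : EKer 4) (R : ℕ) (c e : Fin 4) (t : Pt) :
    truncK K R c e t = if supNorm t ≤ R then K c e t else 0 := rfl

/-- [folklore] The truncation of an even kernel is even (the sup-ball is symmetric). -/
theorem truncK_even {K : EKer 4} (heven : ∀ c e t, K c e (-t) = K c e t) (R : ℕ) (c e : Fin 4) (t : Pt) :
    truncK K R c e (-t) = truncK K R c e t := by
  simp only [truncK_apply, supNorm_neg, heven]

/-- [folklore] The truncation vanishes off the finite box `box 4 R`. -/
theorem truncK_eq_zero_of_not_mem {K : EKer 4} {R : ℕ} {c e : Fin 4} {t : Pt} (ht : t ∉ box 4 R) : truncK K R c e t = 0 := by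
  rw [DyadicShell.not_mem_box_iff] at ht
  simp only [truncK_apply, if_neg (not_le.mpr ht)]

/-- [folklore] A truncated kernel has an absolute second moment (finite support). -/
theorem absMoment₂_truncK (K : EKer 4) (R : ℕ) (c e : Fin 4) : AbsMoment₂ (truncK K R c e) := by
  unfold AbsMoment₂
  refine summable_of_ne_finset_zero (s := box 4 R) (fun t ht => ?_)
  rw [truncK_eq_zero_of_not_mem ht, abs_zero, mul_zero]

/-- [folklore] The moments of the truncation are FINITE sums over the box. -/
theorem tsum_smul_truncK_eq_sum (K : EKer 4) (R : ℕ) (c e : Fin 4) (p : Pt → ℤ) :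
    ∑' t, p t • truncK K R c e t = ∑ t ∈ box 4 R, p t • truncK K R c e t :=
  tsum_eq_sum fun t ht => by rw [truncK_eq_zero_of_not_mem ht, smul_zero]

/-- **ROW H3-BOOK (a) — TRUNCATED TRANSPORT, (T0)-DEFECT DISPLAYED** (`d = 4`, coarse units): for an entrywise EVEN kernel `K` and transport weights `w` with
the Kronecker masses (L0∞), affine constants `Cw` (L1∞) and absolute second moments, the decimated coarse second moment of the `(a, b)` entry of
`Wᵀ·(K·1_{‖·‖∞≤R})·W` is `M₂^{κλ}(K·1_{≤R})_{ab} + N⁶·t0Defect N w (K·1_{≤R}) Cw κ λ a b` — for EVERY `R` and `N ≥ 1`; the (T0)/(T1) hypotheses of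
`DressedMomentNormalisation.secondMoment_dressedEntry_hasSum_lattice` are NOT assumed ((T1) holds by evenness, (T0)'s failure is the displayed defect). [folklore] -/
theorem hasSum_coarse_secondMoment_truncK (hN : 0 < N) (w : EKer 4) (K : EKer 4) (R : ℕ) (Cw : Fin 4 → Fin 4 → Fin 4 → ℝ)
    (hw0 : ∀ κ l, ConstReproSum N (w κ l) (if κ = l then (((N : ℝ) ^ (4 + 1))⁻¹) else 0))
    (hw1 : ∀ κ l, LinReproSum N (w κ l) (Cw κ l)) (hwA : ∀ κ l, AbsMoment₂ (w κ l))
    (heven : ∀ c e t, K c e (-t) = K c e t) (κ lam a b : Fin 4) :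
    HasSum (fun z : Fin 4 → ℤ => ((z κ * z lam : ℤ) : ℝ) * ((N : ℝ) ^ 8 * dressedEntry w (truncK K R) ((N : ℤ) • z) a b))
      ((∑ t ∈ box 4 R, (t κ * t lam) • truncK K R a b t) + (N : ℝ) ^ 6 * t0Defect N w (truncK K R) Cw κ lam a b) := by
  rw [← tsum_smul_truncK_eq_sum]
  exact hasSum_coarse_secondMoment_t0Defect hN w (truncK K R) Cw hw0 hw1 hwA (fun c e => absMoment₂_truncK K R c e)
    (fun c e t => truncK_even heven R c e t) κ lam a b

end Four

end Summit.QuantumFields.BalabanUV.Beta.FP.HorizontalBookkeeping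

end
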